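import Summits.ResolutionOfSingularities.ResolutionOfSingularities.Theorems.FrobeniusLadderFInjectiveMacaulayficationF108ClassRow
import Summits.ResolutionOfSingularities.ResolutionOfSingularities.Theorems.FrobeniusLadderFInjectiveMacaulayficationBrieskornPhamSpecimen
import HarnessLib

/-!
# THE MONOMIAL-FLOOR CONDITIONAL CLASS THEOREM: for a convenient weakly-non-degenerate bed, EVERY `𝔪`-primary MONOMIAL floor `I = (x^B)` is CURED — conditional on the
# relative interface `F108ConsumableRel` («Newton-fan tables for a unimodular refinement of Σ_f ∧ Σ(I) with `(x^A) = I·(x^K)`»), which refines ✓ `F108ClassRow.F108Consumable`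
# (the point floor `I = 𝔪`)
# (crux `FInjectiveMacaulayfication` stmt-ResolutionOfSingularities-15315, chain w45a; res-L1-w45a-plan-1 RULING R22.19 (B‴) «the MONOMIAL-FLOOR CONDITIONAL CLASS THEOREM
# `monomialFloorRow_of_F108Consumable` = ✓p680734/✓p656605 §3 with Σ(𝔪) replaced by Σ(I) for an admissible 𝔪-primary MONOMIAL floor I … say whether `F108Consumable k n` as
# typed already covers Σ(I)-floors or needs a sibling interface (name it; do NOT widen the existing def silently)»; this seat's CHECKPOINT 01:14Z; seat res-L1-w45a-stub-1 g14)

[OURS · L1 W4.5a] Support file (`--supports stmt-ResolutionOfSingularities-15315 --as helper`). ONE DEFINITION (`@[conjecture] def F108ConsumableRel`, an OURS INTERFACE predicate = open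
obligation node — NOT a Literature fact, NOT an admitted print, NOT proved in the kernel) and theorems CONDITIONAL on it through an explicit binder `hF`; §2 is unconditional in
its explicit tables. Nothing of the crux is proved; no census row is proved here. AI-written (AI review is weaker than expert review).

ANSWER TO R22.19's QUESTION. `F108Consumable k n` as typed does NOT cover `Σ(I)`-floors: its first conjunct `span (x^A) = span (X_j) * span (x^KA)` hard-codes the POINT floor
`𝔪`. Everything downstream is floor-agnostic — ✓ `FHalfRowOfWeaklyNondegenerate.affineBlowup_fullCl_of_weaklyNondegenerate` (FULLness of `Bl_{(x^A)} X` from `A`'s tables) and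
✓ `FHalfRowOfProductCentre.fHalfConclusion_of_affineBlowup_mul (τ K) …` (stated for an ARBITRARY first storey `τ`). Hence the SIBLING interface below, with `(x^A) = (x^B)·(x^KA)` for
an `𝔪`-primary monomial `B`; the old definition is untouched and is implied (`f108Consumable_of_rel`, `B = {e_j}`).

HONESTY NOTE ON `F108ConsumableRel`. Classically true by the argument recorded for `F108Consumable` run relative to `I`: `Σ :=` a unimodular projective refinement of
`Σ_f ∧ Σ(B)` (neither fan subdivides the boundary of the orthant, because `f` and `B` contain a pure power of every variable: on a boundary face `{w_S = 0}` the `B`-minimum is `0`,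
attained on one face; star subdivisions never meet coordinate faces); `N_K :=` the polyhedron of a strictly convex support function of `Σ`; `KA :=` generators of `(x^{N_K ∩ ℤⁿ})`
together with the vertices `κ_c` and the edge neighbours `κ_c + w_{c,i}` (lattice points of `N_K`, its edges having lattice length `≥ 1`); `A := B + KA`. Then `N(A) = N(B) + N_K` has
normal fan `Σ(B) ∧ Σ = Σ`, vertices `m_c = b_c + κ_c ∈ A`, neighbours `m_c + w_{c,i} = b_c + (κ_c + w_{c,i}) ∈ A` (the tangent cone of `N(A)` at `m_c` is that of `N_K` at `κ_c`, `σ_c`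
being maximal in both normal fans), `hge`/`hcov` as in the point case. [cite: CoxLittleSchenck2011, Thm. 11.1.9 and §11.4] [cite: IshiiSingularities2018, Thm. 4.4.23] are the
print facts behind it; IT IS NOT PROVED IN THE KERNEL (same toric debt as `F108Consumable`, R22.9 NO-GO for F0–F3 inside this chain) and is carried as a hypothesis.

* §1 `F108ConsumableRel k n : Prop` (definition); `f108Consumable_of_rel : F108ConsumableRel k n → F108Consumable k n`.
* §2 `fHalfRowRel_of_tables` — the DATA version (unconditional in its tables): ✓p656605 §3 with the point floor replaced by `τ = (x^B)`: tables `A, KA, …` with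
  `(x^A) = (x^B)·(x^KA)` in `k[X]/(f)`, `KA` and `B` with pure powers ⇒ for every blowing up `g : S′ → Spec 𝒪_{X,v}` along `(x^B)~·𝒪_{X,v}` there is `𝓚 ≠ ⊥` on `S′` supported
  over the closed point all of whose blowings up are FULL. (Per-floor kernel rows of Q17 arm A = one application each, given stub-2/stub-3-style fan modules.)
* §3 ★★ `monomialFloorCured_of_F108ConsumableRel` — THE ONE-NAME CONDITIONAL THEOREM: `F108ConsumableRel k n →` for `f` prime, convenient, weakly non-degenerate along every
  positive weight, `x̄ᵢ ≠ 0`, `X` regular off the vertex `v` (`k = k̄`, char `p`), and EVERY `𝔪`-primary monomial floor `B`: every blowing up of `Spec 𝒪_{X,v}` along `(x^B)~` is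
  CURED. WHAT IT DOES NOT SAY: nothing about ADMISSIBILITY of the floor (`Bl_I X` CM, regular off the fibre — Q17 arm A's content, per floor) nor NOT-FULLness (per floor, Fedder
  data); the cure needs neither. Conditionally, GAP-1 for convenient-WND beds shrinks to NON-monomial admissible centres.
* §4 `brieskornPham_monomialFloorCured_of_F108ConsumableRel` — every monomial floor of every Brieskorn–Pham bed `z^c + Σ x_j^{a_j}` (`2 ≤ c < a_j`, `a_j ≠ 0` in `k`; `c` free) is
  CURED, conditional on `F108ConsumableRel k 5` (✓ `BrieskornPhamSpecimen`).
-/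

-- single-problem summit: the doubled namespace component is forced
set_option linter.dupNamespace false

noncomputable section

namespace Summit.ResolutionOfSingularities.ResolutionOfSingularities.Theorems.FInjectiveMacaulayfication.MonomialFloorClassRow

open CategoryTheory CategoryTheory.Limits AlgebraicGeometry TopologicalSpace IsLocalRing MvPolynomial
open Literature.AlgebraicGeometry.Resolution Literature.AlgebraicGeometry.Resolution.BoubakriGreuelMarkwig
open Summit.ResolutionOfSingularities.ResolutionOfSingularities.Theorems.FInjectiveMacaulayfication
open SliceableCentre

/-! ## §1 The relative interface -/

/-- **`F108ConsumableRel k n`** — OURS INTERFACE PREDICATE (a hypothesis, NOT a Literature fact, NOT proved in the kernel), the relative form of ✓ `F108ClassRow.F108Consumable`: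
«for every CONVENIENT `f ∈ k[X₀..X_{n−1}]` and every finite exponent set `B` containing a positive pure power of every variable (an `𝔪`-primary MONOMIAL floor `I = (x^B)`) there are
exponent sets `A`, `K` with `(x^A) = (x^B)·(x^K)` in `k[X]`, both containing pure powers of every variable, every `e ∈ A` non-zero, and `t` charts — unimodular `V c`, vertices
`m c ∈ A`, neighbours `a c i ∈ A` with `V c·(a c i) = V c·(m c) + eᵢ`, `V c·(m c) ≤ V c·e` on `A`, the Rees cover, and the Newton refinement certificate (`θ_{V c} f` = monomial × unit
constant term)» — the binder block of §2 / ✓p656605 §3 for the floor `(x^B)`. Believed true (unimodular projective refinement of `Σ_f ∧ Σ(B)` + strictly convex support function +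
`A := B + K`; module docstring). [OURS · definition of an interface predicate; cite: CoxLittleSchenck2011, Thm. 11.1.9 and §11.4; IshiiSingularities2018, Thm. 4.4.23 (the print
facts it packages — not a restatement of either)] -/
@[conjecture] def F108ConsumableRel (k : Type) [Field k] (n : ℕ) : Prop :=
  ∀ f : MvPolynomial (Fin n) k, (∀ j : Fin n, ∃ N : ℕ, 0 < N ∧ MvPolynomial.coeff (Finsupp.single j N) f ≠ 0) →
    ∀ B : Finset (Fin n →₀ ℕ), (∀ j : Fin n, ∃ N : ℕ, 0 < N ∧ Finsupp.single j N ∈ B) →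
    ∃ (A KA : Finset (Fin n →₀ ℕ)) (t : ℕ) (m : Fin t → (Fin n →₀ ℕ)) (V : Fin t → Matrix (Fin n) (Fin n) ℕ) (a : Fin t → Fin n → (Fin n →₀ ℕ))
      (g : Fin t → MvPolynomial (Fin n) k) (d : Fin t → (Fin n →₀ ℕ)),
      Ideal.span ((fun e : Fin n →₀ ℕ => (monomial e (1 : k) : MvPolynomial (Fin n) k)) '' (A : Set (Fin n →₀ ℕ))) =
        Ideal.span ((fun e : Fin n →₀ ℕ => (monomial e (1 : k) : MvPolynomial (Fin n) k)) '' (B : Set (Fin n →₀ ℕ))) *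
          Ideal.span ((fun e : Fin n →₀ ℕ => (monomial e (1 : k) : MvPolynomial (Fin n) k)) '' (KA : Set (Fin n →₀ ℕ))) ∧
      (∀ j : Fin n, ∃ N : ℕ, Finsupp.single j N ∈ KA) ∧
      (∀ j ∈ (Finset.univ : Finset (Fin n)), ∃ N : ℕ, Finsupp.single j N ∈ A) ∧
      (∀ e ∈ A, ∃ j ∈ (Finset.univ : Finset (Fin n)), 0 < e j) ∧
      (∀ e ∈ A, ∃ (c : Fin t) (K : ℕ), 1 ≤ K ∧ ∃ y ∈ (Ideal.span ((fun b : Fin n →₀ ℕ => (monomial b (1 : k) : MvPolynomial (Fin n) k)) '' (A : Set (Fin n →₀ ℕ)))) ^ (K - 1),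
        (monomial e (1 : k) : MvPolynomial (Fin n) k) ^ K = monomial (m c) 1 * y) ∧
      (∀ c, IsUnit ((V c).map (Nat.cast : ℕ → ℤ)).det) ∧
      (∀ c i, a c i ∈ A) ∧
      (∀ (c : Fin t) (i : Fin n), (Finsupp.equivFunOnFinite.symm ((V c).mulVec ⇑(a c i)) : Fin n →₀ ℕ) =
        Finsupp.equivFunOnFinite.symm ((V c).mulVec ⇑(m c)) + Finsupp.single i 1) ∧
      (∀ (c : Fin t), ∀ e ∈ A, (Finsupp.equivFunOnFinite.symm ((V c).mulVec ⇑(m c)) : Fin n →₀ ℕ) ≤ Finsupp.equivFunOnFinite.symm ((V c).mulVec ⇑e)) ∧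
      (∀ c, aeval (fun j : Fin n => ∏ i : Fin n, (X i : MvPolynomial (Fin n) k) ^ V c i j) f = monomial (d c) 1 * g c) ∧
      (∀ c, constantCoeff (g c) ≠ 0) ∧
      (∀ c, m c ∈ A)

variable (k : Type) [Field k] {n : ℕ}

/-- The point floor is the monomial floor `B = {e₀, …, e_{n−1}}`: `(x^{e_j} : j) = (X_j : j)`. [plumbing] -/
theorem span_image_single_one (n : ℕ) :
    Ideal.span ((fun e : Fin n →₀ ℕ => (monomial e (1 : k) : MvPolynomial (Fin n) k)) '' ((Finset.univ.image fun j : Fin n => Finsupp.single j 1 : Finset (Fin n →₀ ℕ)) : Set (Fin n →₀ ℕ))) =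
      Ideal.span (Set.range fun j : Fin n => (X j : MvPolynomial (Fin n) k)) := by
  congr 1
  ext q
  simp only [Finset.coe_image, Finset.coe_univ, Set.image_univ, Set.mem_image, Set.mem_range]
  constructor
  · rintro ⟨_, ⟨j, rfl⟩, rfl⟩
    exact ⟨j, by rw [X_pow_eq_monomial.symm.trans (pow_one _)]⟩
  · rintro ⟨j, rfl⟩
    exact ⟨Finsupp.single j 1, ⟨j, rfl⟩, by rw [← pow_one (X j), X_pow_eq_monomial]⟩

/-- **The relative interface implies the absolute one** (`B :=` the unit vectors). [plumbing] -/
theorem f108Consumable_of_rel (hF : F108ConsumableRel k n) : F108ClassRow.F108Consumable k n := by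
  classical
  intro f hconv
  obtain ⟨A, KA, t, m, V, a, g, d, hIA, hrest⟩ := hF f hconv (Finset.univ.image fun j : Fin n => Finsupp.single j 1)
    (fun j => ⟨1, Nat.one_pos, Finset.mem_image.mpr ⟨j, Finset.mem_univ _, rfl⟩⟩)
  refine ⟨A, KA, t, m, V, a, g, d, ?_, hrest⟩
  rw [hIA, span_image_single_one]

/-! ## §2 The data version: a monomial floor cured from explicit tables -/

/-- **A MONOMIAL FLOOR CURED FROM TABLES** (✓p656605 §3 with the point floor replaced by `τ = (x^B)`): `f` prime, weakly non-degenerate along every positive weight, `x̄ᵢ ≠ 0`, `X`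
regular off the vertex (`k = k̄`, char `p`); tables `A, KA, t, m, V, a, g, d` with `(x̄^A) = (x̄^B)·(x̄^KA)` in `k[X]/(f)`, `KA` and `B` containing pure powers of every variable,
and the chart/cover/Newton certificates ⇒ for EVERY blowing up `g : S′ → Spec 𝒪_{X,v}` along `(x^B)~·𝒪_{X,v}` there is `𝓚 ≠ ⊥` on `S′`, supported over the closed point, all
of whose blowings up are FULL at every stalk. [OURS · assembly; cite: IshiiSingularities2018, Thm. 4.4.23; StacksProject, Tag 080A] -/
theorem fHalfRowRel_of_tables (p : ℕ) [Fact p.Prime] [IsAlgClosed k] [CharP k p] (hn : 0 < n) (f : MvPolynomial (Fin n) k) (hfp : Prime f)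
    (hWND : ∀ w : Fin n → ℝ, (∀ i, 0 < w i) → IsWeaklyNondegenerateAlong w (f : MvPowerSeries (Fin n) k))
    (hXne : ∀ v : Fin n, Ideal.Quotient.mk (Ideal.span {f}) (X v) ≠ 0)
    (hreg : ∀ x : Spec (.of (MvPolynomial (Fin n) k ⧸ Ideal.span {f})),
      ¬ Ideal.span (Set.range fun j : Fin n => Ideal.Quotient.mk (Ideal.span {f}) (X j)) ≤ x.asIdeal → IsRegularLocalRing (Localization.AtPrime x.asIdeal))
    (B : Finset (Fin n →₀ ℕ)) (hB : ∀ j : Fin n, ∃ N : ℕ, 0 < N ∧ Finsupp.single j N ∈ B)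
    (A KA : Finset (Fin n →₀ ℕ))
    (hIA : Ideal.span ((fun e : Fin n →₀ ℕ => Ideal.Quotient.mk (Ideal.span {f}) (monomial e (1 : k))) '' (A : Set (Fin n →₀ ℕ))) =
      Ideal.span ((fun e : Fin n →₀ ℕ => Ideal.Quotient.mk (Ideal.span {f}) (monomial e (1 : k))) '' (B : Set (Fin n →₀ ℕ))) *
        Ideal.span ((fun e : Fin n →₀ ℕ => Ideal.Quotient.mk (Ideal.span {f}) (monomial e (1 : k))) '' (KA : Set (Fin n →₀ ℕ))))
    (hKprim : ∀ j : Fin n, ∃ N : ℕ, Finsupp.single j N ∈ KA)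
    (hprim : ∀ j ∈ (Finset.univ : Finset (Fin n)), ∃ N : ℕ, Finsupp.single j N ∈ A)
    (hAJ : ∀ a ∈ A, ∃ j ∈ (Finset.univ : Finset (Fin n)), 0 < a j)
    (t : ℕ) (m : Fin t → (Fin n →₀ ℕ))
    (hcov : ∀ a ∈ A, ∃ (c : Fin t) (K : ℕ), 1 ≤ K ∧ ∃ y ∈ (Ideal.span ((fun b : Fin n →₀ ℕ => (MvPolynomial.monomial b (1 : k) : MvPolynomial (Fin n) k)) '' (A : Set (Fin n →₀ ℕ)))) ^ (K - 1),
      (MvPolynomial.monomial a (1 : k) : MvPolynomial (Fin n) k) ^ K = MvPolynomial.monomial (m c) 1 * y)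
    (V : Fin t → Matrix (Fin n) (Fin n) ℕ) (hV : ∀ c, IsUnit ((V c).map (Nat.cast : ℕ → ℤ)).det)
    (a : Fin t → Fin n → (Fin n →₀ ℕ)) (haA : ∀ c i, a c i ∈ A)
    (hgen : ∀ (c : Fin t) (i : Fin n), (Finsupp.equivFunOnFinite.symm ((V c).mulVec ⇑(a c i)) : Fin n →₀ ℕ) =
      Finsupp.equivFunOnFinite.symm ((V c).mulVec ⇑(m c)) + Finsupp.single i 1)
    (hge : ∀ (c : Fin t), ∀ e ∈ A, (Finsupp.equivFunOnFinite.symm ((V c).mulVec ⇑(m c)) : Fin n →₀ ℕ) ≤ Finsupp.equivFunOnFinite.symm ((V c).mulVec ⇑e))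
    (g : Fin t → MvPolynomial (Fin n) k) (d : Fin t → (Fin n →₀ ℕ))
    (hθ : ∀ c, aeval (fun j : Fin n => ∏ i : Fin n, (X i : MvPolynomial (Fin n) k) ^ V c i j) f = monomial (d c) 1 * g c)
    (hg0 : ∀ c, constantCoeff (g c) ≠ 0)
    (hv : ∀ c : Fin t, Ideal.Quotient.mk (Ideal.span {f}) (monomial (m c) (1 : k)) ∈
      Ideal.span ((fun e : Fin n →₀ ℕ => Ideal.Quotient.mk (Ideal.span {f}) (monomial e (1 : k))) '' (A : Set (Fin n →₀ ℕ))))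
    (v : Spec (.of (MvPolynomial (Fin n) k ⧸ Ideal.span {f})))
    (hvm : v.asIdeal = Ideal.span (Set.range fun j : Fin n => Ideal.Quotient.mk (Ideal.span {f}) (X j))) :
    ∀ (S' : Scheme.{0}) (gS : S' ⟶ Spec ((Spec (.of (MvPolynomial (Fin n) k ⧸ Ideal.span {f}))).presheaf.stalk v)),
      IsBlowup gS ((affineBlowup.idealSheaf (Ideal.span ((fun e : Fin n →₀ ℕ => Ideal.Quotient.mk (Ideal.span {f}) (monomial e (1 : k))) '' (B : Set (Fin n →₀ ℕ))))).comap
        ((Spec (.of (MvPolynomial (Fin n) k ⧸ Ideal.span {f}))).fromSpecStalk v)) →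
      ∃ 𝓚 : S'.IdealSheafData, 𝓚 ≠ ⊥ ∧
        (∀ s ∈ (𝓚.support : Set S'), gS.base s = closedPoint ((Spec (.of (MvPolynomial (Fin n) k ⧸ Ideal.span {f}))).presheaf.stalk v)) ∧
        ∀ (S'' : Scheme.{0}) (π : S'' ⟶ S'), IsBlowup π 𝓚 → ∀ s : S'', FullCl p (S''.presheaf.stalk s) := by
  classical
  haveI hfprime : (Ideal.span {f}).IsPrime := (Ideal.span_singleton_prime hfp.ne_zero).mpr hfp
  haveI : IsDomain (MvPolynomial (Fin n) k ⧸ Ideal.span {f}) := Ideal.Quotient.isDomain _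
  have hmono : ∀ e : Fin n →₀ ℕ, Ideal.Quotient.mk (Ideal.span {f}) (monomial e (1 : k)) ≠ 0 := fun e =>
    CIConeFiModelCore.mk_monomial_ne_zero (Ideal.span {f}) hXne e
  -- `τ = (x̄^B) ≠ ⊥`, `K ≠ ⊥`, `v ⊆ √K`
  have hτ : Ideal.span ((fun e : Fin n →₀ ℕ => Ideal.Quotient.mk (Ideal.span {f}) (monomial e (1 : k))) '' (B : Set (Fin n →₀ ℕ))) ≠ ⊥ := by
    intro h0
    obtain ⟨N, -, hN⟩ := hB ⟨0, hn⟩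
    exact hmono _ ((Submodule.eq_bot_iff _).mp h0 _ (Ideal.subset_span ⟨_, hN, rfl⟩))
  have hK : Ideal.span ((fun e : Fin n →₀ ℕ => Ideal.Quotient.mk (Ideal.span {f}) (monomial e (1 : k))) '' (KA : Set (Fin n →₀ ℕ))) ≠ ⊥ := by
    intro h0
    obtain ⟨N, hN⟩ := hKprim ⟨0, hn⟩
    exact hmono _ ((Submodule.eq_bot_iff _).mp h0 _ (Ideal.subset_span ⟨_, hN, rfl⟩))
  have hvK : v.asIdeal ≤ (Ideal.span ((fun e : Fin n →₀ ℕ => Ideal.Quotient.mk (Ideal.span {f}) (monomial e (1 : k))) '' (KA : Set (Fin n →₀ ℕ)))).radical := by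
    rw [hvm, Ideal.span_le]
    rintro _ ⟨j, rfl⟩
    obtain ⟨N, hN⟩ := hKprim j
    exact ⟨N, by rw [← map_pow, X_pow_eq_monomial]; exact Ideal.subset_span ⟨_, hN, rfl⟩⟩
  have hrow : ∀ y : ↥(affineBlowup (Ideal.span ((fun e : Fin n →₀ ℕ => Ideal.Quotient.mk (Ideal.span {f}) (monomial e (1 : k))) '' (B : Set (Fin n →₀ ℕ))) *
      Ideal.span ((fun e : Fin n →₀ ℕ => Ideal.Quotient.mk (Ideal.span {f}) (monomial e (1 : k))) '' (KA : Set (Fin n →₀ ℕ))))),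
      FullCl p ((affineBlowup (Ideal.span ((fun e : Fin n →₀ ℕ => Ideal.Quotient.mk (Ideal.span {f}) (monomial e (1 : k))) '' (B : Set (Fin n →₀ ℕ))) *
        Ideal.span ((fun e : Fin n →₀ ℕ => Ideal.Quotient.mk (Ideal.span {f}) (monomial e (1 : k))) '' (KA : Set (Fin n →₀ ℕ))))).presheaf.stalk y) := by
    rw [← hIA]
    exact FHalfRowOfNewtonNondegenerate.affineBlowup_fullCl_of_weaklyNondegenerate p k f hfp hWND hXne hreg A hprim hAJ t m hcov V hV a haA hgen hge g d hθ hg0 hv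
  exact FHalfRowOfProductCentre.fHalfConclusion_of_affineBlowup_mul p _ _ hτ hK v hvK hrow

/-! ## §3 ★★ The one-name conditional theorem -/

/-- The product identity `(x^A) = (x^B)·(x^K)` of `k[X]` read in any quotient `k[X]/F`. [plumbing] -/
theorem span_quotient_eq_mul_rel (F : Ideal (MvPolynomial (Fin n) k)) (A B KA : Finset (Fin n →₀ ℕ))
    (hIA : Ideal.span ((fun e : Fin n →₀ ℕ => (monomial e (1 : k) : MvPolynomial (Fin n) k)) '' (A : Set (Fin n →₀ ℕ))) =
      Ideal.span ((fun e : Fin n →₀ ℕ => (monomial e (1 : k) : MvPolynomial (Fin n) k)) '' (B : Set (Fin n →₀ ℕ))) *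
        Ideal.span ((fun e : Fin n →₀ ℕ => (monomial e (1 : k) : MvPolynomial (Fin n) k)) '' (KA : Set (Fin n →₀ ℕ)))) :
    Ideal.span ((fun e : Fin n →₀ ℕ => Ideal.Quotient.mk F (monomial e (1 : k))) '' (A : Set (Fin n →₀ ℕ))) =
      Ideal.span ((fun e : Fin n →₀ ℕ => Ideal.Quotient.mk F (monomial e (1 : k))) '' (B : Set (Fin n →₀ ℕ))) *
        Ideal.span ((fun e : Fin n →₀ ℕ => Ideal.Quotient.mk F (monomial e (1 : k))) '' (KA : Set (Fin n →₀ ℕ))) := by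
  have h := congrArg (Ideal.map (Ideal.Quotient.mk F)) hIA
  rw [Ideal.map_mul, Ideal.map_span, Ideal.map_span, Ideal.map_span, Set.image_image, Set.image_image, Set.image_image] at h
  exact h

/-- ★★ **EVERY `𝔪`-PRIMARY MONOMIAL FLOOR OF A CONVENIENT WEAKLY-NON-DEGENERATE BED IS CURED, CONDITIONAL ON `F108ConsumableRel k n`.** For `f ∈ k[X₀..X_{n−1}]` (`n ≥ 1`,
`k = k̄`, char `p`) prime, convenient, weakly non-degenerate along every positive weight, with `x̄ᵢ ≠ 0` and `X = V(f)` regular off the vertex `v`, and every finite `B` with a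
positive pure power of every variable: for EVERY blowing up `g : S′ → Spec 𝒪_{X,v}` along the monomial floor `(x^B)~·𝒪_{X,v}` there is `𝓚 ≠ ⊥` on `S′`, supported over the
closed point, ALL of whose blowings up are FULL at every stalk. Says nothing about the floor's admissibility or non-FULLness (per floor, by data). [OURS · conditional class
theorem; cite: IshiiSingularities2018, Thm. 4.4.23] [cite: StacksProject, Tag 080A] -/
theorem monomialFloorCured_of_F108ConsumableRel (p : ℕ) [Fact p.Prime] [IsAlgClosed k] [CharP k p] (hF : F108ConsumableRel k n) (hn : 0 < n)
    (f : MvPolynomial (Fin n) k) (hfp : Prime f) (hconv : ∀ j : Fin n, ∃ N : ℕ, 0 < N ∧ MvPolynomial.coeff (Finsupp.single j N) f ≠ 0)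
    (hWND : ∀ w : Fin n → ℝ, (∀ i, 0 < w i) → IsWeaklyNondegenerateAlong w (f : MvPowerSeries (Fin n) k))
    (hXne : ∀ v : Fin n, Ideal.Quotient.mk (Ideal.span {f}) (X v) ≠ 0)
    (hreg : ∀ x : Spec (.of (MvPolynomial (Fin n) k ⧸ Ideal.span {f})),
      ¬ Ideal.span (Set.range fun j : Fin n => Ideal.Quotient.mk (Ideal.span {f}) (X j)) ≤ x.asIdeal → IsRegularLocalRing (Localization.AtPrime x.asIdeal))
    (B : Finset (Fin n →₀ ℕ)) (hB : ∀ j : Fin n, ∃ N : ℕ, 0 < N ∧ Finsupp.single j N ∈ B)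
    (v : Spec (.of (MvPolynomial (Fin n) k ⧸ Ideal.span {f})))
    (hvm : v.asIdeal = Ideal.span (Set.range fun j : Fin n => Ideal.Quotient.mk (Ideal.span {f}) (X j))) :
    ∀ (S' : Scheme.{0}) (gS : S' ⟶ Spec ((Spec (.of (MvPolynomial (Fin n) k ⧸ Ideal.span {f}))).presheaf.stalk v)),
      IsBlowup gS ((affineBlowup.idealSheaf (Ideal.span ((fun e : Fin n →₀ ℕ => Ideal.Quotient.mk (Ideal.span {f}) (monomial e (1 : k))) '' (B : Set (Fin n →₀ ℕ))))).comap
        ((Spec (.of (MvPolynomial (Fin n) k ⧸ Ideal.span {f}))).fromSpecStalk v)) →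
      ∃ 𝓚 : S'.IdealSheafData, 𝓚 ≠ ⊥ ∧
        (∀ s ∈ (𝓚.support : Set S'), gS.base s = closedPoint ((Spec (.of (MvPolynomial (Fin n) k ⧸ Ideal.span {f}))).presheaf.stalk v)) ∧
        ∀ (S'' : Scheme.{0}) (π : S'' ⟶ S'), IsBlowup π 𝓚 → ∀ s : S'', FullCl p (S''.presheaf.stalk s) := by
  obtain ⟨A, KA, t, m, V, a, g, d, hIA, hKprim, hprim, hAJ, hcov, hV, haA, hgen, hge, hθ, hg0, hm⟩ := hF f hconv B hB
  have hv : ∀ c : Fin t, Ideal.Quotient.mk (Ideal.span {f}) (monomial (m c) (1 : k)) ∈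
      Ideal.span ((fun e : Fin n →₀ ℕ => Ideal.Quotient.mk (Ideal.span {f}) (monomial e (1 : k))) '' (A : Set (Fin n →₀ ℕ))) :=
    fun c => Ideal.subset_span ⟨m c, hm c, rfl⟩
  exact fHalfRowRel_of_tables k p hn f hfp hWND hXne hreg B hB A KA (span_quotient_eq_mul_rel k _ A B KA hIA) hKprim hprim hAJ t m hcov V hV a haA hgen hge g d hθ hg0 hv v hvm

/-! ## §4 The Brieskorn–Pham beds: every monomial floor cured (conditionally) -/

/-- **Every `𝔪`-primary monomial floor of every Brieskorn–Pham bed is CURED, conditional on `F108ConsumableRel k 5`**: `k = k̄` of characteristic `p`, `f = z^c + x^{a₀} + y^{a₁} + u^{a₂} + t^{a₃}`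
with `2 ≤ c < a_j`, `a_j ≠ 0` in `k` (no hypothesis on `c` mod `p`), `B` any finite exponent set with a positive pure power of every variable. One term on §3 with ✓ `BrieskornPhamSpecimen`
(the primality witness `ω^{a₁} = −1` exists in `k = k̄`). [OURS · conditional; cite: IshiiSingularities2018, Thm. 4.4.23] -/
theorem brieskornPham_monomialFloorCured_of_F108ConsumableRel (p : ℕ) [Fact p.Prime] [IsAlgClosed k] [CharP k p] (hF : F108ConsumableRel k 5)
    (c a₀ a₁ a₂ a₃ : ℕ) (hc : 2 ≤ c) (h₀ : c < a₀) (h₁ : c < a₁) (h₂ : c < a₂) (h₃ : c < a₃)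
    (ha₀ : ((a₀ : ℕ) : k) ≠ 0) (ha₁ : ((a₁ : ℕ) : k) ≠ 0) (ha₂ : ((a₂ : ℕ) : k) ≠ 0) (ha₃ : ((a₃ : ℕ) : k) ≠ 0)
    (f : MvPolynomial (Fin 5) k) (hf : f = X 4 ^ c + X 0 ^ a₀ + X 1 ^ a₁ + X 2 ^ a₂ + X 3 ^ a₃)
    (B : Finset (Fin 5 →₀ ℕ)) (hB : ∀ j : Fin 5, ∃ N : ℕ, 0 < N ∧ Finsupp.single j N ∈ B)
    (v : Spec (.of (MvPolynomial (Fin 5) k ⧸ Ideal.span {f})))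
    (hv : v.asIdeal = Ideal.span (Set.range fun j : Fin 5 => Ideal.Quotient.mk (Ideal.span {f}) (X j))) :
    ∀ (S' : Scheme.{0}) (gS : S' ⟶ Spec ((Spec (.of (MvPolynomial (Fin 5) k ⧸ Ideal.span {f}))).presheaf.stalk v)),
      IsBlowup gS ((affineBlowup.idealSheaf (Ideal.span ((fun e : Fin 5 →₀ ℕ => Ideal.Quotient.mk (Ideal.span {f}) (monomial e (1 : k))) '' (B : Set (Fin 5 →₀ ℕ))))).comap
        ((Spec (.of (MvPolynomial (Fin 5) k ⧸ Ideal.span {f}))).fromSpecStalk v)) →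
      ∃ 𝓚 : S'.IdealSheafData, 𝓚 ≠ ⊥ ∧
        (∀ s ∈ (𝓚.support : Set S'), gS.base s = closedPoint ((Spec (.of (MvPolynomial (Fin 5) k ⧸ Ideal.span {f}))).presheaf.stalk v)) ∧
        ∀ (S'' : Scheme.{0}) (π : S'' ⟶ S'), IsBlowup π 𝓚 → ∀ s : S'', FullCl p (S''.presheaf.stalk s) := by
  obtain ⟨ω, hω'⟩ := IsAlgClosed.exists_pow_nat_eq (-1 : k) (n := a₁) (by omega)
  have hω : ω ^ a₁ + 1 = 0 := by rw [hω']; ring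
  exact monomialFloorCured_of_F108ConsumableRel k p hF (by norm_num) f (BrieskornPhamSpecimen.prime_f k c a₀ a₁ a₂ a₃ hc h₂ h₃ ha₀ ω hω f hf)
    (BrieskornPhamSpecimen.convenient_f k c a₀ a₁ a₂ a₃ hc h₀ h₁ h₂ h₃ f hf) (BrieskornPhamSpecimen.weaklyNondegenerate_f k c a₀ a₁ a₂ a₃ ha₀ ha₁ ha₂ ha₃ f hf)
    (BrieskornPhamSpecimen.mk_X_ne_zero k c a₀ a₁ a₂ a₃ hc h₀ h₁ h₂ h₃ ha₀ ω hω f hf)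
    (fun x hx => BrieskornPhamSpecimen.regular_off_vertex k c a₀ a₁ a₂ a₃ hc h₀ h₁ h₂ h₃ ha₀ ha₁ ha₂ ha₃ f hf x.asIdeal hx) B hB v hv

end Summit.ResolutionOfSingularities.ResolutionOfSingularities.Theorems.FInjectiveMacaulayfication.MonomialFloorClassRow

end
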